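import Summits.Ventures.CertifiedArithmetic.LowPrec.GemmEnvelopeRows

/-!
# GEMM-level envelopes, part (e): rows P2, P6, P4 (pub-lowprec gemm gen 22, LXX-e)

HONEST FRAMING: certified error envelopes and provably optimal rounding/accumulation schemes for
low-precision formats under stated cost models; every table by two implementations; no hardware or
vendor claims.

Continuation of `GemmEnvelopeRows`: envelope inclusion (unfolded, see the docstring there) for
P2 (MX-E4M3 ceil vs per-vector E4M3 on `C(κ)`, `2 ≤ κ ≤ 14336`: a TIE — both inclusions hold, the common
sup `35/289` being approached and not attained), P6 (MX-E4M3 ceil vs per-vector E5M2: MX strictly better)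
and P4 (functional F2 = error relative to `K · Aa · Ab`: MX is NOT included in per-vector E4M3 nor in INT8).
Witness numbers reproduced with 0 diff by both pipelines of `certs/gemm/GEMM-ENVELOPES.json`.
[cite: RouhaniEtAl2023MX, §5.1, §6]; [cite: MicikeviciusEtAl2022, §3]; [cite: Higham2002ASNA, §3.1]
-/

namespace Summit.Ventures.CertifiedArithmetic.LowPrec.GemmEnvelope

open Finset
open Literature.ComputerArithmetic.FloatingPoint
open Literature.ComputerArithmetic.FloatingPoint.Format
open Literature.ComputerArithmetic.FloatingPoint.MiniFloat
open Literature.ComputerArithmetic.FloatingPoint.MXBlock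
open Summit.Ventures.CertifiedArithmetic.LowPrec.SR

/-! ## Row P2 — MX-E4M3 (ceil) vs per-vector E4M3: a tie -/

/-- **ROW P2, first half**: `MXC ≼ VEC-E4M3` on `C(κ)` for `2 ≤ κ ≤ 14336`.  The per-vector family
(numerators `maxRat = 448`, all entries `x ↓ 272`) forces every uniform VEC bound to be `≥ 35/289`.
[cite: MicikeviciusEtAl2022, §3] -/
theorem row_P2_mxCeil_le_vecE4M3 {B k : ℕ} (hB : 0 < B) (hk : 0 < k) {κ : ℚ} (hκ1 : 2 ≤ κ)
    (hκ2 : κ ≤ 14336) (q : ℚ)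
    (hY : ∀ (a b : Fin B → Fin k → ℚ) (Aa Ab : ℚ),
      (∀ j i, |a j i| ≤ Aa ∧ (a j i = 0 ∨ Aa ≤ κ * |a j i|)) →
      (∀ j i, |b j i| ≤ Ab ∧ (b j i = 0 ∨ Ab ≤ κ * |b j i|)) →
      |∑ j, ∑ i, (Aa / E4M3.maxRat * (roundNE E4M3 (a j i / (Aa / E4M3.maxRat))).toRat) *
          (Ab / E4M3.maxRat * (roundNE E4M3 (b j i / (Ab / E4M3.maxRat))).toRat)
          - ∑ j, ∑ i, a j i * b j i| ≤ q * ∑ j, ∑ i, |a j i * b j i|)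
    (a b : Fin B → Fin k → ℚ) (Aa Ab : ℚ)
    (ha : ∀ j i, |a j i| ≤ Aa ∧ (a j i = 0 ∨ Aa ≤ κ * |a j i|))
    (hb : ∀ j i, |b j i| ≤ Ab ∧ (b j i = 0 ∨ Ab ≤ κ * |b j i|)) :
    |∑ j, ∑ i, (ceilScale E4M3 (a j) * (roundNE E4M3 (a j i / ceilScale E4M3 (a j))).toRat) *
        (ceilScale E4M3 (b j) * (roundNE E4M3 (b j i / ceilScale E4M3 (b j))).toRat)
        - ∑ j, ∑ i, a j i * b j i| ≤ q * ∑ j, ∑ i, |a j i * b j i| := by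
  have hM : E4M3.maxRat = 448 := by decide +kernel
  have hq : 35 / 289 ≤ q := by
    refine le_of_forall_approach fun x hx1 hx2 => ?_
    have hx0 : 0 < x := by linarith
    have hmem : ∀ (j : Fin B) (i : Fin k), |(fun (_ : Fin B) (_ : Fin k) => x) j i| ≤ E4M3.maxRat ∧
        ((fun (_ : Fin B) (_ : Fin k) => x) j i = 0 ∨
          E4M3.maxRat ≤ κ * |(fun (_ : Fin B) (_ : Fin k) => x) j i|) := fun _ _ => by
      refine ⟨by rw [abs_of_pos hx0, hM]; linarith, Or.inr ?_⟩
      rw [abs_of_pos hx0, hM]; nlinarith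
    have hw := hY _ _ E4M3.maxRat E4M3.maxRat hmem hmem
    have hv : E4M3.maxRat / E4M3.maxRat * (roundNE E4M3 (x / (E4M3.maxRat / E4M3.maxRat))).toRat
        = 288 := by
      rw [div_self (by rw [hM]; norm_num), div_one, one_mul]
      exact toRat_roundNE_E4M3_eq_288 hx1 hx2.le
    simp only [hv] at hw
    exact (ratio_le_of_const_witness hB hk (mul_pos hx0 hx0) hw).1
  have hL : 0 ≤ ∑ j, ∑ i, |a j i * b j i| :=
    Finset.sum_nonneg fun j _ => Finset.sum_nonneg fun i _ => abs_nonneg _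
  exact le_trans (mxCeil_blocked_le a b hκ2 ha hb) (mul_le_mul_of_nonneg_right hq hL)

/-- **ROW P2, second half (and the `VEC ≼ MX` half of ROW P5)**: `VEC-E4M3 ≼ MXC` on `C(κ)` for
`1 ≤ κ ≤ 28672` (the MX family, all entries `x ↓ 272` with scale `1`, forces every uniform MX bound to be
`≥ 35/289`; the per-vector envelope is `35/289` as long as `κ ≤ 28672`).  Together with the first half:
a TIE of envelopes on `2 ≤ κ ≤ 14336` (extended to `κ ≤ 258048/17` in part f). [cite: RouhaniEtAl2023MX, §6.1] -/
theorem row_P2_vecE4M3_le_mxCeil {B k : ℕ} (hB : 0 < B) (hk : 0 < k) {κ : ℚ} (hκ1 : 1 ≤ κ)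
    (hκ2 : κ ≤ 28672) (q : ℚ)
    (hY : ∀ (a b : Fin B → Fin k → ℚ) (Aa Ab : ℚ),
      (∀ j i, |a j i| ≤ Aa ∧ (a j i = 0 ∨ Aa ≤ κ * |a j i|)) →
      (∀ j i, |b j i| ≤ Ab ∧ (b j i = 0 ∨ Ab ≤ κ * |b j i|)) →
      |∑ j, ∑ i, (ceilScale E4M3 (a j) * (roundNE E4M3 (a j i / ceilScale E4M3 (a j))).toRat) *
          (ceilScale E4M3 (b j) * (roundNE E4M3 (b j i / ceilScale E4M3 (b j))).toRat)
          - ∑ j, ∑ i, a j i * b j i| ≤ q * ∑ j, ∑ i, |a j i * b j i|)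
    (a b : Fin B → Fin k → ℚ) (Aa Ab : ℚ)
    (ha : ∀ j i, |a j i| ≤ Aa ∧ (a j i = 0 ∨ Aa ≤ κ * |a j i|))
    (hb : ∀ j i, |b j i| ≤ Ab ∧ (b j i = 0 ∨ Ab ≤ κ * |b j i|)) :
    |∑ j, ∑ i, (Aa / E4M3.maxRat * (roundNE E4M3 (a j i / (Aa / E4M3.maxRat))).toRat) *
        (Ab / E4M3.maxRat * (roundNE E4M3 (b j i / (Ab / E4M3.maxRat))).toRat)
        - ∑ j, ∑ i, a j i * b j i| ≤ q * ∑ j, ∑ i, |a j i * b j i| := by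
  obtain ⟨n, rfl⟩ : ∃ n, k = n + 1 := ⟨k - 1, by omega⟩
  have hq : 35 / 289 ≤ q := by
    refine le_of_forall_approach fun x hx1 hx2 => ?_
    have hx0 : 0 < x := by linarith
    have hmem : ∀ (j : Fin B) (i : Fin (n + 1)), |(fun (_ : Fin B) (_ : Fin (n + 1)) => x) j i| ≤ x ∧
        ((fun (_ : Fin B) (_ : Fin (n + 1)) => x) j i = 0 ∨
          x ≤ κ * |(fun (_ : Fin B) (_ : Fin (n + 1)) => x) j i|) := fun _ _ => by
      refine ⟨by rw [abs_of_pos hx0], Or.inr ?_⟩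
      rw [abs_of_pos hx0]; nlinarith
    have hw := hY _ _ x x hmem hmem
    have h288 : ceilScale E4M3 (fun _ : Fin (n + 1) => x) *
        (roundNE E4M3 (x / ceilScale E4M3 (fun _ : Fin (n + 1) => x))).toRat = 288 := by
      have h := mxCeil_const_eq_288 n hx1 hx2.le (0 : Fin (n + 1)); beta_reduce at h; exact h
    simp only [h288] at hw
    exact (ratio_le_of_const_witness hB (Nat.succ_pos n) (mul_pos hx0 hx0) hw).1
  have hL : 0 ≤ ∑ j, ∑ i, |a j i * b j i| :=
    Finset.sum_nonneg fun j _ => Finset.sum_nonneg fun i _ => abs_nonneg _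
  exact le_trans (vecE4M3_blocked_le a b (by linarith) ha hb) (mul_le_mul_of_nonneg_right hq hL)

/-! ## Row P6 — MX-E4M3 (ceil) vs per-vector E5M2 -/

/-- **ROW P6**: on `C(κ)`, `2 ≤ κ ≤ 14336`, `MXC ≼ VEC-E5M2` holds and `VEC-E5M2 ≼ MXC` FAILS: the
per-vector E5M2 input with all entries `38000` and numerators `maxRat = 57344` has relative error
`(40960² − 38000²)/38000² = 36519/225625 > 35/289`. [cite: MicikeviciusEtAl2022, §3] -/
theorem row_P6_mxCeil_vs_vecE5M2 {B k : ℕ} (hB : 0 < B) (hk : 0 < k) {κ : ℚ} (hκ1 : 2 ≤ κ)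
    (hκ2 : κ ≤ 14336) :
    (∀ q : ℚ, (∀ (a b : Fin B → Fin k → ℚ) (Aa Ab : ℚ),
        (∀ j i, |a j i| ≤ Aa ∧ (a j i = 0 ∨ Aa ≤ κ * |a j i|)) →
        (∀ j i, |b j i| ≤ Ab ∧ (b j i = 0 ∨ Ab ≤ κ * |b j i|)) →
        |∑ j, ∑ i, (Aa / E5M2.maxRat * (roundNE E5M2 (a j i / (Aa / E5M2.maxRat))).toRat) *
            (Ab / E5M2.maxRat * (roundNE E5M2 (b j i / (Ab / E5M2.maxRat))).toRat)
            - ∑ j, ∑ i, a j i * b j i| ≤ q * ∑ j, ∑ i, |a j i * b j i|) →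
      ∀ (a b : Fin B → Fin k → ℚ) (Aa Ab : ℚ),
        (∀ j i, |a j i| ≤ Aa ∧ (a j i = 0 ∨ Aa ≤ κ * |a j i|)) →
        (∀ j i, |b j i| ≤ Ab ∧ (b j i = 0 ∨ Ab ≤ κ * |b j i|)) →
        |∑ j, ∑ i, (ceilScale E4M3 (a j) * (roundNE E4M3 (a j i / ceilScale E4M3 (a j))).toRat) *
            (ceilScale E4M3 (b j) * (roundNE E4M3 (b j i / ceilScale E4M3 (b j))).toRat)
            - ∑ j, ∑ i, a j i * b j i| ≤ q * ∑ j, ∑ i, |a j i * b j i|) ∧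
    ∃ q : ℚ, (∀ (a b : Fin B → Fin k → ℚ) (Aa Ab : ℚ),
        (∀ j i, |a j i| ≤ Aa ∧ (a j i = 0 ∨ Aa ≤ κ * |a j i|)) →
        (∀ j i, |b j i| ≤ Ab ∧ (b j i = 0 ∨ Ab ≤ κ * |b j i|)) →
        |∑ j, ∑ i, (ceilScale E4M3 (a j) * (roundNE E4M3 (a j i / ceilScale E4M3 (a j))).toRat) *
            (ceilScale E4M3 (b j) * (roundNE E4M3 (b j i / ceilScale E4M3 (b j))).toRat)
            - ∑ j, ∑ i, a j i * b j i| ≤ q * ∑ j, ∑ i, |a j i * b j i|) ∧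
      ∃ (a b : Fin B → Fin k → ℚ) (Aa Ab : ℚ),
        (∀ j i, |a j i| ≤ Aa ∧ (a j i = 0 ∨ Aa ≤ κ * |a j i|)) ∧
        (∀ j i, |b j i| ≤ Ab ∧ (b j i = 0 ∨ Ab ≤ κ * |b j i|)) ∧
        q * ∑ j, ∑ i, |a j i * b j i| <
        |∑ j, ∑ i, (Aa / E5M2.maxRat * (roundNE E5M2 (a j i / (Aa / E5M2.maxRat))).toRat) *
            (Ab / E5M2.maxRat * (roundNE E5M2 (b j i / (Ab / E5M2.maxRat))).toRat)
            - ∑ j, ∑ i, a j i * b j i| := by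
  have hM : E5M2.maxRat = 57344 := by decide +kernel
  have hmem : ∀ (j : Fin B) (i : Fin k), |(fun (_ : Fin B) (_ : Fin k) => (38000 : ℚ)) j i| ≤ E5M2.maxRat ∧
      ((fun (_ : Fin B) (_ : Fin k) => (38000 : ℚ)) j i = 0 ∨
        E5M2.maxRat ≤ κ * |(fun (_ : Fin B) (_ : Fin k) => (38000 : ℚ)) j i|) := fun _ _ => by
    refine ⟨by rw [abs_of_pos (by norm_num), hM]; norm_num, Or.inr ?_⟩
    rw [abs_of_pos (by norm_num), hM]; linarith
  have hv : E5M2.maxRat / E5M2.maxRat * (roundNE E5M2 (38000 / (E5M2.maxRat / E5M2.maxRat))).toRat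
      = 40960 := by
    rw [div_self (by rw [hM]; norm_num), div_one, one_mul]
    exact witness_values.2.2.2.2.2.2.1
  have hL : ∀ (a b : Fin B → Fin k → ℚ), 0 ≤ ∑ j, ∑ i, |a j i * b j i| := fun a b =>
    Finset.sum_nonneg fun j _ => Finset.sum_nonneg fun i _ => abs_nonneg _
  refine ⟨fun q hY a b Aa Ab ha hb => ?_,
    ⟨35 / 289, fun a b Aa Ab ha hb => mxCeil_blocked_le a b hκ2 ha hb, ?_⟩⟩
  · have hw := hY _ _ E5M2.maxRat E5M2.maxRat hmem hmem
    simp only [hv] at hw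
    have hq := (ratio_le_of_const_witness hB hk (by norm_num : (0 : ℚ) < 38000 * 38000) hw).1
    norm_num at hq
    exact le_trans (mxCeil_blocked_le a b hκ2 ha hb)
      (mul_le_mul_of_nonneg_right (by linarith) (hL a b))
  · refine ⟨fun _ _ => 38000, fun _ _ => 38000, E5M2.maxRat, E5M2.maxRat, hmem, hmem, ?_⟩
    simp only [hv, sum_const, card_univ, Fintype.card_fin, nsmul_eq_mul]
    have hBk : (0 : ℚ) < (B : ℚ) * (k : ℚ) := by
      have : (0 : ℚ) < (k : ℚ) := by exact_mod_cast hk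
      positivity
    rw [abs_of_pos (by norm_num : (0 : ℚ) < 38000 * 38000),
      abs_of_pos (by nlinarith : (0 : ℚ) < (B : ℚ) * ((k : ℚ) * (40960 * 40960))
        - (B : ℚ) * ((k : ℚ) * (38000 * 38000)))]
    nlinarith

/-! ## Row P4 — functional F2 (relative to `K · Aa · Ab`): MX is not included in the per-vector datapaths -/

/-- **ROW P4 (vs per-vector E4M3)**: under F2 the per-vector E4M3 datapath satisfies the uniform bound
`57/784` on ALL covering inputs (absolute element error `≤ A/28`), while the MX all-`272` input (numerators
`272`) has F2-error `33/289 > 57/784`: `MXC ≼ VEC-E4M3` FAILS under F2. [cite: Higham2002ASNA, §3.1] -/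
theorem row_P4_F2_vecE4M3 {B k : ℕ} (hB : 0 < B) (hk : 0 < k) :
    ∃ q : ℚ, (∀ (a b : Fin B → Fin k → ℚ) (Aa Ab : ℚ), 0 < Aa → 0 < Ab →
        (∀ j i, |a j i| ≤ Aa) → (∀ j i, |b j i| ≤ Ab) →
        |∑ j, ∑ i, (Aa / E4M3.maxRat * (roundNE E4M3 (a j i / (Aa / E4M3.maxRat))).toRat) *
            (Ab / E4M3.maxRat * (roundNE E4M3 (b j i / (Ab / E4M3.maxRat))).toRat)
            - ∑ j, ∑ i, a j i * b j i| ≤ q * (((B * k : ℕ) : ℚ) * (Aa * Ab))) ∧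
      ∃ (a b : Fin B → Fin k → ℚ) (Aa Ab : ℚ), 0 < Aa ∧ 0 < Ab ∧
        (∀ j i, |a j i| ≤ Aa) ∧ (∀ j i, |b j i| ≤ Ab) ∧
        q * (((B * k : ℕ) : ℚ) * (Aa * Ab)) <
        |∑ j, ∑ i, (ceilScale E4M3 (a j) * (roundNE E4M3 (a j i / ceilScale E4M3 (a j))).toRat) *
            (ceilScale E4M3 (b j) * (roundNE E4M3 (b j i / ceilScale E4M3 (b j))).toRat)
            - ∑ j, ∑ i, a j i * b j i| := by
  obtain ⟨n, rfl⟩ : ∃ n, k = n + 1 := ⟨k - 1, by omega⟩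
  refine ⟨57 / 784, fun a b Aa Ab hAa hAb ha hb => ?_, ?_⟩
  · have h := abs_sum_mul_sub_sum_mul_le_abs_unif (ι := Fin B × Fin (n + 1))
      (a := fun p => a p.1 p.2) (b := fun p => b p.1 p.2)
      (qa := fun p => Aa / E4M3.maxRat * (roundNE E4M3 (a p.1 p.2 / (Aa / E4M3.maxRat))).toRat)
      (qb := fun p => Ab / E4M3.maxRat * (roundNE E4M3 (b p.1 p.2 / (Ab / E4M3.maxRat))).toRat)
      (ea := Aa / 28) (eb := Ab / 28) (A := Aa) (B' := Ab) (by positivity)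
      (fun p => vec_abs_error_le_E4M3 (ha p.1 p.2) hAa) (fun p => vec_abs_error_le_E4M3 (hb p.1 p.2) hAb)
      (fun p => ha p.1 p.2) (fun p => hb p.1 p.2)
    simp only [Fintype.sum_prod_type, Fintype.card_prod, Fintype.card_fin] at h
    refine le_trans h (le_of_eq ?_)
    push_cast; ring
  · have hmem : ∀ (j : Fin B) (i : Fin (n + 1)), |(fun (_ : Fin B) (_ : Fin (n + 1)) => (272 : ℚ)) j i| ≤ 272 :=
      fun _ _ => by rw [abs_of_pos (by norm_num)]
    refine ⟨fun _ _ => 272, fun _ _ => 272, 272, 272, by norm_num, by norm_num, hmem, hmem, ?_⟩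
    have h256 : ceilScale E4M3 (fun _ : Fin (n + 1) => (272 : ℚ)) *
        (roundNE E4M3 (272 / ceilScale E4M3 (fun _ : Fin (n + 1) => (272 : ℚ)))).toRat = 256 := by
      have h := mxCeil_const_272 n (0 : Fin (n + 1)); beta_reduce at h; exact h
    simp only [h256, sum_const, card_univ, Fintype.card_fin, nsmul_eq_mul]
    have hBk : (0 : ℚ) < (B : ℚ) * ((n + 1 : ℕ) : ℚ) := by positivity
    rw [abs_of_neg (by nlinarith : (B : ℚ) * (((n + 1 : ℕ) : ℚ) * (256 * 256))
        - (B : ℚ) * (((n + 1 : ℕ) : ℚ) * (272 * 272)) < 0)]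
    push_cast
    nlinarith

/-- **ROW P4 (vs INT8)**: under F2 the INT8 datapath satisfies the uniform bound `509/64516` on ALL covering
inputs (absolute element error `≤ A/254`), while the MX all-`272` input has F2-error `33/289`:
`MXC ≼ INT8` FAILS under F2. [cite: Higham2002ASNA, §3.1] -/
theorem row_P4_F2_int8 {B k : ℕ} (hB : 0 < B) (hk : 0 < k) :
    ∃ q : ℚ, (∀ (a b : Fin B → Fin k → ℚ) (Aa Ab : ℚ), 0 < Aa → 0 < Ab →
        (∀ j i, |a j i| ≤ Aa) → (∀ j i, |b j i| ≤ Ab) →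
        |∑ j, ∑ i, (Aa / 127 * (round (a j i / (Aa / 127)) : ℚ)) *
            (Ab / 127 * (round (b j i / (Ab / 127)) : ℚ)) - ∑ j, ∑ i, a j i * b j i|
          ≤ q * (((B * k : ℕ) : ℚ) * (Aa * Ab))) ∧
      ∃ (a b : Fin B → Fin k → ℚ) (Aa Ab : ℚ), 0 < Aa ∧ 0 < Ab ∧
        (∀ j i, |a j i| ≤ Aa) ∧ (∀ j i, |b j i| ≤ Ab) ∧
        q * (((B * k : ℕ) : ℚ) * (Aa * Ab)) <
        |∑ j, ∑ i, (ceilScale E4M3 (a j) * (roundNE E4M3 (a j i / ceilScale E4M3 (a j))).toRat) *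
            (ceilScale E4M3 (b j) * (roundNE E4M3 (b j i / ceilScale E4M3 (b j))).toRat)
            - ∑ j, ∑ i, a j i * b j i| := by
  obtain ⟨n, rfl⟩ : ∃ n, k = n + 1 := ⟨k - 1, by omega⟩
  refine ⟨509 / 64516, fun a b Aa Ab hAa hAb ha hb => ?_, ?_⟩
  · have hea : ∀ v : ℚ, |Aa / 127 * (round (v / (Aa / 127)) : ℚ) - v| ≤ Aa / 254 := fun v =>
      le_trans (intQ_abs_error_le (by positivity) v) (by apply le_of_eq; ring)
    have heb : ∀ v : ℚ, |Ab / 127 * (round (v / (Ab / 127)) : ℚ) - v| ≤ Ab / 254 := fun v =>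
      le_trans (intQ_abs_error_le (by positivity) v) (by apply le_of_eq; ring)
    have h := abs_sum_mul_sub_sum_mul_le_abs_unif (ι := Fin B × Fin (n + 1))
      (a := fun p => a p.1 p.2) (b := fun p => b p.1 p.2)
      (qa := fun p => Aa / 127 * (round (a p.1 p.2 / (Aa / 127)) : ℚ))
      (qb := fun p => Ab / 127 * (round (b p.1 p.2 / (Ab / 127)) : ℚ))
      (ea := Aa / 254) (eb := Ab / 254) (A := Aa) (B' := Ab) (by positivity)
      (fun p => hea (a p.1 p.2)) (fun p => heb (b p.1 p.2)) (fun p => ha p.1 p.2) (fun p => hb p.1 p.2)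
    simp only [Fintype.sum_prod_type, Fintype.card_prod, Fintype.card_fin] at h
    refine le_trans h (le_of_eq ?_)
    push_cast; ring
  · have hmem : ∀ (j : Fin B) (i : Fin (n + 1)), |(fun (_ : Fin B) (_ : Fin (n + 1)) => (272 : ℚ)) j i| ≤ 272 :=
      fun _ _ => by rw [abs_of_pos (by norm_num)]
    refine ⟨fun _ _ => 272, fun _ _ => 272, 272, 272, by norm_num, by norm_num, hmem, hmem, ?_⟩
    have h256 : ceilScale E4M3 (fun _ : Fin (n + 1) => (272 : ℚ)) *
        (roundNE E4M3 (272 / ceilScale E4M3 (fun _ : Fin (n + 1) => (272 : ℚ)))).toRat = 256 := by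
      have h := mxCeil_const_272 n (0 : Fin (n + 1)); beta_reduce at h; exact h
    simp only [h256, sum_const, card_univ, Fintype.card_fin, nsmul_eq_mul]
    have hBk : (0 : ℚ) < (B : ℚ) * ((n + 1 : ℕ) : ℚ) := by positivity
    rw [abs_of_neg (by nlinarith : (B : ℚ) * (((n + 1 : ℕ) : ℚ) * (256 * 256))
        - (B : ℚ) * (((n + 1 : ℕ) : ℚ) * (272 * 272)) < 0)]
    push_cast
    nlinarith

end Summit.Ventures.CertifiedArithmetic.LowPrec.GemmEnvelope
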